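import Summits.QuantumFields.YangMills.Theses.FradkinShenkerFlow
import Summits.QuantumFields.YangMills.Theses.ConvexGribovBody
import Summits.QuantumFields.YangMills.Theses.ModularSelfDualFold
import Summits.QuantumFields.YangMills.Theses.EquipartitionCriticality
import Summits.QuantumFields.YangMills.Theses.RandomConstraintAnnealing
import Summits.QuantumFields.YangMills.Theorems.FiniteSusceptibilityWeakCoupling.Negative.BetaZeroClause
import Summits.QuantumFields.YangMills.Theorems.FradkinShenkerFlowFiniteSusceptibilityWeakCouplingOddTorusRP
import Summits.QuantumFields.YangMills.Theorems.FradkinShenkerFlowFiniteSusceptibilityWeakCouplingRPCauchySchwarz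
import Summits.QuantumFields.YangMills.Theorems.FradkinShenkerFlowFiniteSusceptibilityWeakCouplingMirrorDominationAxis0
import Summits.QuantumFields.YangMills.Theorems.FradkinShenkerFlowFiniteSusceptibilityWeakCouplingMirrorReduction
import Summits.QuantumFields.YangMills.Theorems.FradkinShenkerFlowFiniteSusceptibilityWeakCouplingShellSummation
import Summits.QuantumFields.YangMills.Theorems.FradkinShenkerFlowFiniteSusceptibilityWeakCouplingAxisIsotropy
import Literature.MathematicalPhysics.QuantumFieldTheory.LatticeGaugeProofs
import HarnessLib

/-!
# The RP funnel of crux `FiniteSusceptibilityWeakCoupling` (item stmt-QuantumFields-9442), assembled: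
# time-axis cubic moments, time clustering, and the sibling lattice-gap legs each imply the crux

Support file for item stmt-QuantumFields-9442 (route `FradkinShenkerFlow` of `YangMills`), line
`sup-axis-reflection-transfer` (crux directory `Cruxes/FiniteSusceptibilityWeakCoupling/`). The line's six provable
stubs are landed (`stub_oddTorusRP`, `stub_rpCauchySchwarz`, `stub_mirrorDominationAxis0`, `stub_mirrorReduction`,
`stub_shellSummation`, `stub_axisIsotropy`, files `FradkinShenkerFlowFiniteSusceptibilityWeakCoupling<Stub>.lean`);
the seventh, `stub_axialCubicMoment` = `C⁺` (time-axis cubic-moment summability of all gauge-invariant covariances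
at weak coupling for compact simple `G`), is the infrared half of the four-dimensional lattice mass-gap problem in
its weakest (summability) form and stays OPEN. This file composes the landed stubs into kernel-checked
IMPLICATIONS, so that the crux is reduced, unconditionally, to existing statements:

* `stub_cruxOfAxialCubicMoment` / `finiteSusceptibilityWeakCoupling_of_axialCubicMoment` : `C⁺ →` crux (the skeleton's
  composition, sorry-free; registered on the item as a proved sub-goal so that this support file attaches to it);
* `finiteSusceptibilityWeakCoupling_of_timeClusteringEventually` : volume-uniform exponential clustering in
  Euclidean time at all `β ≥ β₁(G, r)` (pair-dependent constants and volume thresholds) `→` crux;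
* the SIBLING ATTACHMENTS (refuter notes g15-10 / g41-7 made precise): each of the lattice-gap legs
  `ConvexGribovBody.UniformLatticeGap` (item 8778), `ModularSelfDualFold.WeakCouplingLatticeGap` (8901),
  `EquipartitionCriticality.LatticeGapLargeBeta` (8761), `RandomConstraintAnnealing.TubeGapLatticeLeg` (8715)
  implies the crux. (`GronwallGap.LatticeGapOffTransitions`, 8799, is NOT attached: its exceptional set is only
  locally finite, so it yields `∃ β₀ ∀ β ≥ β₀` only if that set is bounded.)

All implications hold for every compact `G`; simplicity of `G` is merely carried through the hypotheses. No
definition is introduced (hypotheses are spelled out or are existing route declarations), so nothing here is a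
named fact. Mathematics: Osterwalder–Seiler reflection positivity on the odd torus (tree,
`wilsonExpectation_oddReflectionPositive`), midpoint-mirror Cauchy–Schwarz, the `d = 4` shell count, and
`Σ (n+1)³ e^{-mn} < ∞`.
-/

noncomputable section

open MeasureTheory ProbabilityTheory
open scoped BigOperators
open Literature.MathematicalPhysics.QuantumFieldTheory hiding Site ZdEdge
open Literature.MathematicalPhysics.QuantumLattice
open Literature.Probability.LatticeModels hiding configShift configShift_apply

namespace Summit.QuantumFields.YangMills.Theorems.FiniteSusceptibilityWeakCoupling

namespace SiblingFunnel

variable {G : Type} [Group G] [TopologicalSpace G] [IsTopologicalGroup G] [CompactSpace G]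
  [MeasurableSpace G] [BorelSpace G]

/-- **The funnel at fixed coupling** (every compact `G`, every `β ≥ 0`): cubic axis moments for all pairs along
the time axis ⇒ the crux's inner clause (finite susceptibility, uniformly in the torus). Stubs 1 → 2a → 2b → 2c give
mirror domination, stub 4 spreads the moments to all axes, stub 3 sums the shells. -/
theorem susceptibility_of_axialMoments (r : LatticeRep G) {β : ℝ} (hβ : 0 ≤ β)
    (hMom : ∀ A B : YMSpecies G, ∃ M : ℝ, ∀ S : ℕ,
      ∑ n ∈ Finset.range (S + 1), ((n : ℝ) + 1) ^ 3 *
        |cov[fun U => A.F (torusLift (2 * S + 1) U),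
            fun U => B.F (configShift (-(Pi.single 0 (n : ℤ))) (torusLift (2 * S + 1) U));
            wilsonMeasure (d := 4) (L := 2 * S + 1) r.ρ β]| ≤ M) :
    ∀ A B : YMSpecies G, ∃ χ : ℝ, ∀ S : ℕ,
      ∑ x ∈ box 4 S, |cov[fun U => A.F (torusLift (2 * S + 1) U),
          fun U => B.F (configShift (-x) (torusLift (2 * S + 1) U));
          wilsonMeasure (d := 4) (L := 2 * S + 1) r.ρ β]| ≤ χ := by
  intro A B
  obtain ⟨k, P, Q, c, w, n₀, hc, hdom⟩ :=
    stub_mirrorReduction (stub_mirrorDominationAxis0 (stub_rpCauchySchwarz stub_oddTorusRP)) G r β hβ A B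
  obtain ⟨a, ha⟩ := A.bounded
  obtain ⟨b, hb⟩ := B.bounded
  have hMom' := stub_axisIsotropy G r β hMom
  choose Mf hMf using fun p : Fin k × Fin 4 => hMom' p.2 (P p.1) (Q p.1)
  obtain ⟨C, hC⟩ := stub_shellSummation n₀ w (4 * a * b) c (∑ p : Fin k × Fin 4, Mf p)
  refine ⟨C, fun S => ?_⟩
  haveI : IsProbabilityMeasure (wilsonMeasure (d := 4) (L := 2 * S + 1) r.ρ β) :=
    isProbabilityMeasure_wilsonMeasure _ r.continuous β
  refine hC S
    (fun x => cov[fun U => A.F (torusLift (2 * S + 1) U),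
        fun U => B.F (configShift (-x) (torusLift (2 * S + 1) U));
        wilsonMeasure (d := 4) (L := 2 * S + 1) r.ρ β])
    (fun j => ∑ i : Fin k, ∑ μ : Fin 4,
        |cov[fun U => (P i).F (torusLift (2 * S + 1) U),
            fun U => (Q i).F (configShift (-(Pi.single μ (j : ℤ))) (torusLift (2 * S + 1) U));
            wilsonMeasure (d := 4) (L := 2 * S + 1) r.ρ β]|)
    hc ?_ ?_ ?_ ?_
  · intro x _
    exact Negative.abs_covariance_le_of_abs_le (fun U => ha _) (fun U => hb _)
  · intro j
    exact Finset.sum_nonneg fun i _ => Finset.sum_nonneg fun μ _ => abs_nonneg _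
  · calc ∑ j ∈ Finset.range (S + 1), ((j : ℝ) + 1) ^ 3 * ∑ i : Fin k, ∑ μ : Fin 4,
            |cov[fun U => (P i).F (torusLift (2 * S + 1) U),
                fun U => (Q i).F (configShift (-(Pi.single μ (j : ℤ))) (torusLift (2 * S + 1) U));
                wilsonMeasure (d := 4) (L := 2 * S + 1) r.ρ β]|
          = ∑ i : Fin k, ∑ μ : Fin 4, ∑ j ∈ Finset.range (S + 1), ((j : ℝ) + 1) ^ 3 *
              |cov[fun U => (P i).F (torusLift (2 * S + 1) U),
                  fun U => (Q i).F (configShift (-(Pi.single μ (j : ℤ))) (torusLift (2 * S + 1) U));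
                  wilsonMeasure (d := 4) (L := 2 * S + 1) r.ρ β]| := by
            simp_rw [Finset.mul_sum]
            rw [Finset.sum_comm]
            refine Finset.sum_congr rfl fun i _ => ?_
            rw [Finset.sum_comm]
      _ ≤ ∑ i : Fin k, ∑ μ : Fin 4, Mf (i, μ) :=
            Finset.sum_le_sum fun i _ => Finset.sum_le_sum fun μ _ => hMf (i, μ) S
      _ = ∑ p : Fin k × Fin 4, Mf p := (Fintype.sum_prod_type _).symm
  · intro x hx hn
    exact hdom S x hx hn

/-- The crux's axis covariance IS the tree's connected time-correlator `latticeConnectedCorr` (bounded measurable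
integrands under a probability measure; the shifted mean equals the unshifted one by translation invariance of the
torus state). -/
theorem covariance_eq_latticeConnectedCorr (r : LatticeRep G) (β : ℝ) (A B : YMSpecies G) (S n : ℕ) :
    cov[fun U => A.F (torusLift (2 * S + 1) U),
        fun U => B.F (configShift (-(Pi.single 0 (n : ℤ))) (torusLift (2 * S + 1) U));
        wilsonMeasure (d := 4) (L := 2 * S + 1) r.ρ β] =
      latticeConnectedCorr r.ρ β (2 * S + 1) A.F B.F n := by
  haveI : IsProbabilityMeasure (wilsonMeasure (d := 4) (L := 2 * S + 1) r.ρ β) :=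
    isProbabilityMeasure_wilsonMeasure _ r.continuous β
  obtain ⟨a, ha⟩ := A.bounded
  obtain ⟨b, hb⟩ := B.bounded
  have hmA : Measurable fun U : GaugeConfig 4 (2 * S + 1) G => A.F (torusLift (2 * S + 1) U) :=
    A.measurable.comp (measurable_torusLift _)
  have hmB : Measurable fun U : GaugeConfig 4 (2 * S + 1) G =>
      B.F (configShift (-(Pi.single 0 (n : ℤ))) (torusLift (2 * S + 1) U)) :=
    B.measurable.comp ((configShift _).measurable.comp (measurable_torusLift _))
  have l₁ : MemLp (fun U : GaugeConfig 4 (2 * S + 1) G => A.F (torusLift (2 * S + 1) U)) 2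
      (wilsonMeasure (d := 4) (L := 2 * S + 1) r.ρ β) :=
    MemLp.of_bound hmA.aestronglyMeasurable a (ae_of_all _ fun U => by
      simpa [Real.norm_eq_abs] using ha _)
  have l₂ : MemLp (fun U : GaugeConfig 4 (2 * S + 1) G =>
      B.F (configShift (-(Pi.single 0 (n : ℤ))) (torusLift (2 * S + 1) U))) 2
      (wilsonMeasure (d := 4) (L := 2 * S + 1) r.ρ β) :=
    MemLp.of_bound hmB.aestronglyMeasurable b (ae_of_all _ fun U => by
      simpa [Real.norm_eq_abs] using hb _)
  rw [covariance_eq_sub l₁ l₂]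
  have hmean : ∫ U, B.F (configShift (-(Pi.single 0 (n : ℤ))) (torusLift (2 * S + 1) U))
        ∂(wilsonMeasure (d := 4) (L := 2 * S + 1) r.ρ β) =
      ∫ U, B.F (torusLift (2 * S + 1) U) ∂(wilsonMeasure (d := 4) (L := 2 * S + 1) r.ρ β) := by
    have h1 := toTorusObservable_comp_configShift (G := G) (2 * S + 1) (-(Pi.single 0 (n : ℤ))) B.F
    have h2 := wilsonExpectation_comp_torusConfigShift (d := 4) (L := 2 * S + 1) r.ρ β
      (Literature.Probability.LatticeModels.Torus.proj (2 * S + 1) (-(Pi.single 0 (n : ℤ))))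
      (toTorusObservable (2 * S + 1) B.F)
    rw [← h1] at h2
    simpa [wilsonExpectation, toTorusObservable, Function.comp] using h2
  unfold latticeConnectedCorr
  simp only [Pi.mul_apply]
  rw [hmean]

/-- Cubic moments of an exponentially decaying sequence are summable: `Σ (n+1)³ e^{-mn} < ∞` for `m > 0`. -/
theorem summable_cube_mul_exp {m : ℝ} (hm : 0 < m) :
    Summable fun n : ℕ => ((n : ℝ) + 1) ^ 3 * Real.exp (-(m * n)) := by
  have hs : ∀ k : ℕ, Summable fun n : ℕ => (n : ℝ) ^ k * Real.exp (-(m * n)) := fun k => by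
    simpa [neg_mul] using Real.summable_pow_mul_exp_neg_nat_mul k hm
  have heq : (fun n : ℕ => ((n : ℝ) + 1) ^ 3 * Real.exp (-(m * n))) = fun n : ℕ =>
      (n : ℝ) ^ 3 * Real.exp (-(m * n)) + 3 * ((n : ℝ) ^ 2 * Real.exp (-(m * n))) +
        3 * ((n : ℝ) ^ 1 * Real.exp (-(m * n))) + (n : ℝ) ^ 0 * Real.exp (-(m * n)) := by
    funext n; ring
  rw [heq]
  exact (((hs 3).add ((hs 2).mul_left 3)).add ((hs 1).mul_left 3)).add (hs 0)

/-- **Clustering ⇒ cubic moments at fixed `(G, r, β)`.** Exponential time clustering with rate `m > 0`, a constant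
per pair and a pair-dependent volume threshold gives the time-axis cubic-moment bound for every pair:
`Σ_{n ≤ S} (n+1)³ C e^{-mn} ≤ |C| Σ_n (n+1)³ e^{-mn}`, the finitely many tori `S < S₀` being absorbed by
`|Cov| ≤ 4‖A‖∞‖B‖∞`. -/
theorem axialMoments_of_clusteringAt (r : LatticeRep G) (β : ℝ) {m : ℝ} (hm : 0 < m)
    (hAB : ∀ A B : YMSpecies G, ∃ (C : ℝ) (S₀ : ℕ), ∀ S : ℕ, S₀ ≤ S → ∀ n : ℕ, n ≤ S →
        |latticeConnectedCorr r.ρ β (2 * S + 1) A.F B.F n| ≤ C * Real.exp (-(m * n))) :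
    ∀ A B : YMSpecies G, ∃ M : ℝ, ∀ S : ℕ,
      ∑ n ∈ Finset.range (S + 1), ((n : ℝ) + 1) ^ 3 *
        |cov[fun U => A.F (torusLift (2 * S + 1) U),
            fun U => B.F (configShift (-(Pi.single 0 (n : ℤ))) (torusLift (2 * S + 1) U));
            wilsonMeasure (d := 4) (L := 2 * S + 1) r.ρ β]| ≤ M := by
  intro A B
  obtain ⟨C, S₀, hC⟩ := hAB A B
  obtain ⟨a, ha⟩ := A.bounded
  obtain ⟨b, hb⟩ := B.bounded
  have hab : 0 ≤ 4 * a * b := by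
    have ha0 : 0 ≤ a := (abs_nonneg _).trans (ha fun _ => 1)
    have hb0 : 0 ≤ b := (abs_nonneg _).trans (hb fun _ => 1)
    positivity
  set T : ℝ := ∑' n : ℕ, ((n : ℝ) + 1) ^ 3 * Real.exp (-(m * n)) with hT
  have hTs := summable_cube_mul_exp hm
  have hT0 : 0 ≤ T := tsum_nonneg fun n => by positivity
  refine ⟨|C| * T + (S₀ : ℝ) ^ 4 * (4 * a * b), fun S => ?_⟩
  haveI : IsProbabilityMeasure (wilsonMeasure (d := 4) (L := 2 * S + 1) r.ρ β) :=
    isProbabilityMeasure_wilsonMeasure _ r.continuous β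
  by_cases hS : S₀ ≤ S
  · calc ∑ n ∈ Finset.range (S + 1), ((n : ℝ) + 1) ^ 3 *
            |cov[fun U => A.F (torusLift (2 * S + 1) U),
                fun U => B.F (configShift (-(Pi.single 0 (n : ℤ))) (torusLift (2 * S + 1) U));
                wilsonMeasure (d := 4) (L := 2 * S + 1) r.ρ β]|
          ≤ ∑ n ∈ Finset.range (S + 1), |C| * (((n : ℝ) + 1) ^ 3 * Real.exp (-(m * n))) := by
            refine Finset.sum_le_sum fun n hn => ?_
            have hn' : n ≤ S := Nat.lt_succ_iff.mp (Finset.mem_range.mp hn)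
            have h1 := hC S hS n hn'
            rw [← covariance_eq_latticeConnectedCorr r β A B S n] at h1
            have h2 : C * Real.exp (-(m * n)) ≤ |C| * Real.exp (-(m * n)) :=
              mul_le_mul_of_nonneg_right (le_abs_self C) (Real.exp_nonneg _)
            calc ((n : ℝ) + 1) ^ 3 * |cov[fun U => A.F (torusLift (2 * S + 1) U),
                    fun U => B.F (configShift (-(Pi.single 0 (n : ℤ))) (torusLift (2 * S + 1) U));
                    wilsonMeasure (d := 4) (L := 2 * S + 1) r.ρ β]|
                ≤ ((n : ℝ) + 1) ^ 3 * (|C| * Real.exp (-(m * n))) :=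
                  mul_le_mul_of_nonneg_left (h1.trans h2) (by positivity)
              _ = |C| * (((n : ℝ) + 1) ^ 3 * Real.exp (-(m * n))) := by ring
      _ = |C| * ∑ n ∈ Finset.range (S + 1), ((n : ℝ) + 1) ^ 3 * Real.exp (-(m * n)) := by
            rw [Finset.mul_sum]
      _ ≤ |C| * T := by
            refine mul_le_mul_of_nonneg_left ?_ (abs_nonneg C)
            exact hTs.sum_le_tsum _ fun n _ => by positivity
      _ ≤ |C| * T + (S₀ : ℝ) ^ 4 * (4 * a * b) := le_add_of_nonneg_right (by positivity)
  · push Not at hS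
    calc ∑ n ∈ Finset.range (S + 1), ((n : ℝ) + 1) ^ 3 *
            |cov[fun U => A.F (torusLift (2 * S + 1) U),
                fun U => B.F (configShift (-(Pi.single 0 (n : ℤ))) (torusLift (2 * S + 1) U));
                wilsonMeasure (d := 4) (L := 2 * S + 1) r.ρ β]|
          ≤ ∑ _n ∈ Finset.range (S + 1), (S₀ : ℝ) ^ 3 * (4 * a * b) := by
            refine Finset.sum_le_sum fun n hn => ?_
            have hn' : n ≤ S := Nat.lt_succ_iff.mp (Finset.mem_range.mp hn)
            have hnS : (n : ℝ) + 1 ≤ S₀ := by exact_mod_cast (show n + 1 ≤ S₀ by omega)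
            have hcov : |cov[fun U => A.F (torusLift (2 * S + 1) U),
                fun U => B.F (configShift (-(Pi.single 0 (n : ℤ))) (torusLift (2 * S + 1) U));
                wilsonMeasure (d := 4) (L := 2 * S + 1) r.ρ β]| ≤ 4 * a * b :=
              Negative.abs_covariance_le_of_abs_le (fun U => ha _) (fun U => hb _)
            exact mul_le_mul (pow_le_pow_left₀ (by positivity) hnS 3) hcov (abs_nonneg _) (by positivity)
      _ = ((S + 1 : ℕ) : ℝ) * ((S₀ : ℝ) ^ 3 * (4 * a * b)) := by
            rw [Finset.sum_const, Finset.card_range, nsmul_eq_mul]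
      _ ≤ (S₀ : ℝ) * ((S₀ : ℝ) ^ 3 * (4 * a * b)) := by
            refine mul_le_mul_of_nonneg_right ?_ (by positivity)
            exact_mod_cast (show S + 1 ≤ S₀ by omega)
      _ = (S₀ : ℝ) ^ 4 * (4 * a * b) := by ring
      _ ≤ |C| * T + (S₀ : ℝ) ^ 4 * (4 * a * b) := le_add_of_nonneg_left (by positivity)

end SiblingFunnel

open SiblingFunnel

/-- **`C⁺ ⇒` crux** (the line's composition, kernel-checked; registered on the item as the sub-goal
`stub_cruxOfAxialCubicMoment`): time-axis cubic-moment summability of all gauge-invariant covariances at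
`β ≥ β₀(G, r)` (the OPEN stub `stub_axialCubicMoment` of the line, here the antecedent, verbatim) implies
`FiniteSusceptibilityWeakCoupling`, with `β₀ ↦ max β₀ 0`. -/
theorem stub_cruxOfAxialCubicMoment : (∀ (G : Type) [Group G] [TopologicalSpace G] [IsTopologicalGroup G] [CompactSpace G] [MeasurableSpace G] [BorelSpace G], Literature.MathematicalPhysics.QuantumFieldTheory.IsCompactSimpleLieGroup G → ∀ (r : Literature.MathematicalPhysics.QuantumFieldTheory.LatticeRep G), ∃ β₀ : ℝ, ∀ β : ℝ, β₀ ≤ β → ∀ A B : Literature.MathematicalPhysics.QuantumFieldTheory.YMSpecies G, ∃ M : ℝ, ∀ S : ℕ, ∑ n ∈ Finset.range (S + 1), ((n : ℝ) + 1) ^ 3 * |ProbabilityTheory.covariance (fun U => A.F (Literature.MathematicalPhysics.QuantumLattice.torusLift (2 * S + 1) U)) (fun U => B.F (Literature.MathematicalPhysics.QuantumLattice.configShift (-(Pi.single 0 (n : ℤ))) (Literature.MathematicalPhysics.QuantumLattice.torusLift (2 * S + 1) U))) (Literature.MathematicalPhysics.QuantumFieldTheory.wilsonMeasure (d := 4)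 (L := 2 * S + 1) r.ρ β)| ≤ M) → Summit.QuantumFields.YangMills.Theses.FradkinShenkerFlow.FiniteSusceptibilityWeakCoupling := by
  intro h₅ G _ _ _ _ _ _ hG r
  obtain ⟨β₀, hβ₀⟩ := h₅ G hG r
  refine ⟨max β₀ 0, fun β hβ => ?_⟩
  have h0 : (0 : ℝ) ≤ β := le_trans (le_max_right _ _) hβ
  have h1 : β₀ ≤ β := le_trans (le_max_left _ _) hβ
  exact susceptibility_of_axialMoments r h0 (hβ₀ β h1)

/-- `C⁺ ⇒` crux with a named hypothesis (convenience form of `stub_cruxOfAxialCubicMoment`). -/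
theorem finiteSusceptibilityWeakCoupling_of_axialCubicMoment
    (h₅ : ∀ (G : Type) [Group G] [TopologicalSpace G] [IsTopologicalGroup G] [CompactSpace G]
      [MeasurableSpace G] [BorelSpace G], IsCompactSimpleLieGroup G → ∀ (r : LatticeRep G),
      ∃ β₀ : ℝ, ∀ β : ℝ, β₀ ≤ β → ∀ A B : YMSpecies G, ∃ M : ℝ, ∀ S : ℕ,
        ∑ n ∈ Finset.range (S + 1), ((n : ℝ) + 1) ^ 3 *
          |cov[fun U => A.F (torusLift (2 * S + 1) U),
              fun U => B.F (configShift (-(Pi.single 0 (n : ℤ))) (torusLift (2 * S + 1) U));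
              wilsonMeasure (d := 4) (L := 2 * S + 1) r.ρ β]| ≤ M) :
    Summit.QuantumFields.YangMills.Theses.FradkinShenkerFlow.FiniteSusceptibilityWeakCoupling :=
  stub_cruxOfAxialCubicMoment h₅

/-- **Time clustering ⇒ crux.** Volume-uniform exponential clustering in Euclidean time at every `β ≥ β₁(G, r)`
(rate `m(β) > 0`, constant per pair, pair-dependent volume threshold — the common shape of the sub-problem's
lattice-gap legs) implies `FiniteSusceptibilityWeakCoupling`. -/
theorem finiteSusceptibilityWeakCoupling_of_timeClusteringEventually
    (h : ∀ (G : Type) [Group G] [TopologicalSpace G] [IsTopologicalGroup G] [CompactSpace G]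
      [MeasurableSpace G] [BorelSpace G], IsCompactSimpleLieGroup G → ∀ (r : LatticeRep G),
      ∃ β₁ : ℝ, ∀ β : ℝ, β₁ ≤ β → ∃ m : ℝ, 0 < m ∧ ∀ A B : YMSpecies G, ∃ (C : ℝ) (S₀ : ℕ),
        ∀ S : ℕ, S₀ ≤ S → ∀ n : ℕ, n ≤ S →
          |latticeConnectedCorr r.ρ β (2 * S + 1) A.F B.F n| ≤ C * Real.exp (-(m * n))) :
    Summit.QuantumFields.YangMills.Theses.FradkinShenkerFlow.FiniteSusceptibilityWeakCoupling := by
  refine finiteSusceptibilityWeakCoupling_of_axialCubicMoment fun G _ _ _ _ _ _ hG r => ?_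
  obtain ⟨β₁, hβ₁⟩ := h G hG r
  refine ⟨β₁, fun β hβ => ?_⟩
  obtain ⟨m, hm, hAB⟩ := hβ₁ β hβ
  exact axialMoments_of_clusteringAt r β hm hAB

/-- **Sibling attachment 1 (item stmt-QuantumFields-8778).** `ConvexGribovBody.UniformLatticeGap` — the
volume-uniform weak-coupling lattice mass gap with a pair-independent volume threshold — implies the crux. -/
theorem finiteSusceptibilityWeakCoupling_of_uniformLatticeGap
    (h : Summit.QuantumFields.YangMills.Theses.ConvexGribovBody.UniformLatticeGap) :
    Summit.QuantumFields.YangMills.Theses.FradkinShenkerFlow.FiniteSusceptibilityWeakCoupling := by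
  refine finiteSusceptibilityWeakCoupling_of_timeClusteringEventually fun G _ _ _ _ _ _ hG r => ?_
  obtain ⟨β₀, hβ₀⟩ := h G hG r
  refine ⟨β₀, fun β hβ => ?_⟩
  obtain ⟨m, hm, S₁, hS₁⟩ := hβ₀ β hβ
  refine ⟨m, hm, fun A B => ?_⟩
  obtain ⟨C, hC⟩ := hS₁ A B
  exact ⟨C, S₁, fun S hS n hn => hC S n hS hn⟩

/-- **Sibling attachment 2 (item stmt-QuantumFields-8901).** `ModularSelfDualFold.WeakCouplingLatticeGap` —
massiveness at every large bare coupling with a `β`-uniform prefactor — implies the crux. -/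
theorem finiteSusceptibilityWeakCoupling_of_weakCouplingLatticeGap
    (h : Summit.QuantumFields.YangMills.Theses.ModularSelfDualFold.WeakCouplingLatticeGap) :
    Summit.QuantumFields.YangMills.Theses.FradkinShenkerFlow.FiniteSusceptibilityWeakCoupling := by
  refine finiteSusceptibilityWeakCoupling_of_timeClusteringEventually fun G _ _ _ _ _ _ hG r => ?_
  obtain ⟨β₁, m, hm, hAB⟩ := h G hG r
  refine ⟨β₁, fun β hβ => ⟨m β, hm β hβ, fun A B => ?_⟩⟩
  obtain ⟨C, S₀, hC⟩ := hAB A B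
  exact ⟨C, S₀, fun S hS n hn => hC β hβ S hS n hn⟩

/-- **Sibling attachment 3 (item stmt-QuantumFields-8761).** `EquipartitionCriticality.LatticeGapLargeBeta`
(stated with the Borel σ-algebra `borel G`; our arbitrary `[BorelSpace G]` instance is rewritten to it by
`BorelSpace.measurable_eq`) implies the crux. -/
theorem finiteSusceptibilityWeakCoupling_of_latticeGapLargeBeta
    (h : Summit.QuantumFields.YangMills.Theses.EquipartitionCriticality.LatticeGapLargeBeta) :
    Summit.QuantumFields.YangMills.Theses.FradkinShenkerFlow.FiniteSusceptibilityWeakCoupling := by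
  refine finiteSusceptibilityWeakCoupling_of_timeClusteringEventually fun G _ _ _ _ iM iB hG r => ?_
  have hM : iM = borel G := BorelSpace.measurable_eq
  subst hM
  obtain ⟨β₁, m, S₀, hm, hAB⟩ := h G hG r
  refine ⟨β₁, fun β hβ => ⟨m β, hm β hβ, fun A B => ?_⟩⟩
  obtain ⟨C, hC⟩ := hAB A B
  exact ⟨C, S₀ β, fun S hS n hn => hC β hβ S n hS hn⟩

/-- **Sibling attachment 4 (item stmt-QuantumFields-8715).** `RandomConstraintAnnealing.TubeGapLatticeLeg`
(Borel σ-algebra, as above) implies the crux. -/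
theorem finiteSusceptibilityWeakCoupling_of_tubeGapLatticeLeg
    (h : Summit.QuantumFields.YangMills.Theses.RandomConstraintAnnealing.TubeGapLatticeLeg) :
    Summit.QuantumFields.YangMills.Theses.FradkinShenkerFlow.FiniteSusceptibilityWeakCoupling := by
  refine finiteSusceptibilityWeakCoupling_of_timeClusteringEventually fun G _ _ _ _ iM iB hG r => ?_
  have hM : iM = borel G := BorelSpace.measurable_eq
  subst hM
  obtain ⟨β₀, m, S₀, hm, hAB⟩ := h G hG r
  refine ⟨β₀, fun β hβ => ⟨m β, hm β hβ, fun A B => ?_⟩⟩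
  obtain ⟨C, hC⟩ := hAB A B
  exact ⟨C, S₀ β, fun S hS n hn => hC β hβ S hS n hn⟩

end Summit.QuantumFields.YangMills.Theorems.FiniteSusceptibilityWeakCoupling

end
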